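import Summits.QuantumAdvantage.QuantumAdvantage.Theorems.CubicForrelationNearExactIsExactTwelveWildParity

/-!
# Crux `CubicForrelation.NearExactIsExact` (stmt-QuantumAdvantage-14043) — n = 12, level ≥ 6 below the second boundary: the residual
  off the 9-flat and the congruences (H3)/(H4) on it

Certificate seat `b2b-cforr-cert` (gen 13).  HONEST FRAMING: lemmas (standard axioms) for the theorem `tw6_levelSix_window` of
`…TwelveLevelSixWindow.lean`; finite-slice bookkeeping about cubic Boolean pairs on 12 bits, NOT summit progress.

Setting: cubic `f, g : 𝔽₂¹² → 𝔽₂` with `W_g = 64·u''` (level `≥ 6` of the 2-adic tower), `s = (−1)^f`, residual `e = u'' − s`,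
`Z = {u'' even}` a 9-flat `x_Z ⊕ V₀` (forced when `Σ e² < 768`, see the main file).
* `tw6_off_flat`: if `Σ_{x ∉ Z} e(x)² ≤ 56` then `e = 0` off `Z`.  On a coset `p ⊕ V₀` with `p ∉ Z` the residual is even; its 6-flat sums are
  `≡ 0 (mod 4)` and its 7-flat sums `≡ 0 (mod 8)` (general flat sums `fs_flat_sum_dvd` of `u = 4u''` and Ax for `(−1)^f`), so by the
  Reed–Muller distance on the abstract flat (`ws_erm_round`) `e/2` is odd at `≥ 16` points (cost `≥ 64`) or even everywhere, then `e/4` is odd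
  at `≥ 8` points (cost `≥ 128`) or even everywhere, and finally a single point with `8 ∣ e ≠ 0` costs `64 > 56`.
* `tw6_H34`: once `e = 0` off `Z`, three directions transversal to `V₀` (`ep_dirs3`) localise the 6- and 7-flat sums of `u − 4s = 4e` to `Z`
  (`ep_loc3`): (H3) `4 ∣ Σ_{3-flat ⊂ Z} e`, (H4) `8 ∣ Σ_{4-flat ⊂ Z} e` — verbatim the mechanism of `tw12_levelSix_ge` (there `e = ±1`).

References: J. Ax (1964) / R. J. McEliece (1972); MacWilliams–Sloane (1977) Ch. 13 §3.  Everything below is proved from Mathlib and the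
tree; axioms are the standard three.
-/

set_option linter.dupNamespace false -- D-0017: single-problem summit ⇒ `QuantumAdvantage.QuantumAdvantage` by design

noncomputable section

namespace Summit.QuantumAdvantage.QuantumAdvantage.Theorems.CubicForrelation.NearExactIsExact

open Finset
open Literature.Computability.QuantumComplexity
open Literature.Computability.QuantumComplexity.BuzetChailloux (bxor zeroVec bxor_bxor_cancel_left bxor_zeroVec zeroVec_bxor bxor_comm
  bxor_self)
open Literature.Computability.QuantumComplexity.DerivativeWalsh (W)

/-! ### Level ≥ 6 below the second boundary, step 1: the residual vanishes off the 9-flat -/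

/-- **Off the flat the residual vanishes.**  Cubic `f, g` on 12 bits with `W_g = 64u''`; `Z = {u'' even}` a coset `x_Z ⊕ V₀` of an
xor-closed `V₀ ∋ 0` with `2⁹` elements; if the residual `e = u'' − (−1)^f` has `Σ_{x ∉ Z} e(x)² ≤ 56` then `e = 0` off `Z`
(three rounds of wild-point parity on the cosets `p ⊕ V₀`, `p ∉ Z`: `4 ∣ e`, `8 ∣ e`, `e = 0`). [this work] -/
theorem tw6_off_flat (f g : (Fin (6 + 6) → Bool) → Bool) (hf : IsDegLeFun 3 f) (hg : IsDegLeFun 3 g)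
    (u'' : (Fin (6 + 6) → Bool) → ℤ) (hu'' : ∀ x, W (fun y => signOf (g y)) x = (2 : ℝ) ^ 6 * (u'' x : ℝ))
    (V₀ : Finset (Fin (6 + 6) → Bool)) (xZ : Fin (6 + 6) → Bool) (h0 : zeroVec ∈ V₀)
    (hadd : ∀ a ∈ V₀, ∀ b ∈ V₀, bxor a b ∈ V₀) (hcardV9 : #V₀ = 2 ^ 9)
    (hS : (univ.filter fun x : Fin (6 + 6) → Bool => ¬ Odd (u'' x)) = V₀.image (bxor xZ))
    (hoff_le : ∑ x ∈ univ.filter (fun x => x ∉ (univ.filter fun x : Fin (6 + 6) → Bool => ¬ Odd (u'' x))),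
      (u'' x - sZ (f x)) ^ 2 ≤ 56) :
    ∀ y, y ∉ (univ.filter fun x : Fin (6 + 6) → Bool => ¬ Odd (u'' x)) → u'' y - sZ (f y) = 0 := by
  classical
  set Z := univ.filter (fun x : Fin (6 + 6) → Bool => ¬ Odd (u'' x)) with hZdef
  have hmemZ : ∀ x, x ∈ Z ↔ ¬ Odd (u'' x) := fun x => by simp [hZdef]
  set u : (Fin (6 + 6) → Bool) → ℤ := fun x => 4 * u'' x with hudef
  have hu : ∀ x, W (fun y => signOf (g y)) x = (2 : ℝ) ^ 4 * (u x : ℝ) := by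
    intro x; rw [hu'' x]; simp only [u]; push_cast; ring
  set e : (Fin (6 + 6) → Bool) → ℤ := fun x => u'' x - sZ (f x) with hedef
  show ∀ y, y ∉ Z → e y = 0
  have hFe : ∀ y, u y - 4 * sZ (f y) = 4 * e y := fun y => by simp only [u, e]; ring
  have heeven : ∀ x, x ∉ Z → Even (e x) := by
    intro x hx
    have hodd : Odd (u'' x) := not_not.1 fun h => hx ((hmemZ x).2 h)
    rcases tp_sZ_cases (f x) with hs | hs <;> simp only [e] <;> rw [hs]
    · exact Int.even_sub.2 (iff_of_false (Int.not_even_iff_odd.2 hodd) (by decide))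
    · exact Int.even_sub.2 (iff_of_false (Int.not_even_iff_odd.2 hodd) (by decide))
  have hPV' : ∀ x, x ∉ Z → ∀ a ∈ V₀, bxor x a ∉ Z := fun x hx a ha => fl1_coset_out' hadd hS hx ha

  -- flat sums of `4e = u − 4s`: `16 ∣` on 6-flats, `32 ∣` on 7-flats
  have hflat6 : ∀ (b : Fin (6 + 6) → Bool) (a : Fin 6 → Fin (6 + 6) → Bool),
      (4 : ℤ) ∣ ∑ ε : Fin 6 → Bool, e (fun j => b j ^^ decide (Odd #(univ.filter fun i => ε i && a i j))) := by
    intro b a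
    have h1 := fs_flat_sum_dvd (e := 4) g u hg hu b a (by norm_num)
    obtain ⟨zf, hzf⟩ := sl_sum_sZ_flat f hf b a
    have hzf' : ∑ ε : Fin 6 → Bool, 4 * sZ (f (fun j => b j ^^ decide (Odd #(univ.filter fun i => ε i && a i j)))) = 16 * zf := by
      rw [← mul_sum, hzf]; norm_num; ring
    have h1' : (16 : ℤ) ∣ ∑ ε : Fin 6 → Bool, u (fun j => b j ^^ decide (Odd #(univ.filter fun i => ε i && a i j))) := by
      have e16 : (2 : ℤ) ^ 4 = 16 := by norm_num
      rw [e16] at h1; exact h1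
    have h2 : (16 : ℤ) ∣ ∑ ε : Fin 6 → Bool, (u (fun j => b j ^^ decide (Odd #(univ.filter fun i => ε i && a i j))) -
        4 * sZ (f (fun j => b j ^^ decide (Odd #(univ.filter fun i => ε i && a i j))))) := by
      rw [sum_sub_distrib, hzf']
      exact dvd_sub h1' (Dvd.intro _ rfl)
    have h3 : ∑ ε : Fin 6 → Bool, (u (fun j => b j ^^ decide (Odd #(univ.filter fun i => ε i && a i j))) -
        4 * sZ (f (fun j => b j ^^ decide (Odd #(univ.filter fun i => ε i && a i j))))) =
        4 * ∑ ε : Fin 6 → Bool, e (fun j => b j ^^ decide (Odd #(univ.filter fun i => ε i && a i j))) := by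
      rw [mul_sum]; exact sum_congr rfl fun ε _ => hFe _
    rw [h3] at h2
    obtain ⟨k, hk⟩ := h2
    exact ⟨k, by linarith⟩
  have hflat7 : ∀ (b : Fin (6 + 6) → Bool) (a : Fin 7 → Fin (6 + 6) → Bool),
      (8 : ℤ) ∣ ∑ ε : Fin 7 → Bool, e (fun j => b j ^^ decide (Odd #(univ.filter fun i => ε i && a i j))) := by
    intro b a
    have h1 := fs_flat_sum_dvd (e := 5) g u hg hu b a (by norm_num)
    obtain ⟨zf, hzf⟩ := sl_sum_sZ_flat f hf b a
    have hzf' : ∑ ε : Fin 7 → Bool, 4 * sZ (f (fun j => b j ^^ decide (Odd #(univ.filter fun i => ε i && a i j)))) = 32 * zf := by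
      rw [← mul_sum, hzf]; norm_num; ring
    have h1' : (32 : ℤ) ∣ ∑ ε : Fin 7 → Bool, u (fun j => b j ^^ decide (Odd #(univ.filter fun i => ε i && a i j))) := by
      have e32 : (2 : ℤ) ^ 5 = 32 := by norm_num
      rw [e32] at h1; exact h1
    have h2 : (32 : ℤ) ∣ ∑ ε : Fin 7 → Bool, (u (fun j => b j ^^ decide (Odd #(univ.filter fun i => ε i && a i j))) -
        4 * sZ (f (fun j => b j ^^ decide (Odd #(univ.filter fun i => ε i && a i j))))) := by
      rw [sum_sub_distrib, hzf']
      exact dvd_sub h1' (Dvd.intro _ rfl)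
    have h3 : ∑ ε : Fin 7 → Bool, (u (fun j => b j ^^ decide (Odd #(univ.filter fun i => ε i && a i j))) -
        4 * sZ (f (fun j => b j ^^ decide (Odd #(univ.filter fun i => ε i && a i j))))) =
        4 * ∑ ε : Fin 7 → Bool, e (fun j => b j ^^ decide (Odd #(univ.filter fun i => ε i && a i j))) := by
      rw [mul_sum]; exact sum_congr rfl fun ε _ => hFe _
    rw [h3] at h2
    obtain ⟨k, hk⟩ := h2
    exact ⟨k, by linarith⟩
  -- OFF-Z KILL, round 1: `4 ∣ e` off `Z`
  have hcos_out : ∀ p, p ∉ Z → ∀ b ∈ V₀.image (bxor p), b ∉ Z := by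
    intro p hp b hb
    obtain ⟨v, hv, rfl⟩ := mem_image.1 hb
    exact hPV' p hp v hv
  have hoff_count : ∀ (T : Finset (Fin (6 + 6) → Bool)) (c : ℤ), (∀ x ∈ T, x ∉ Z) → (∀ x ∈ T, c ≤ e x ^ 2) →
      c * #T ≤ 56 := by
    intro T c hT hc
    calc c * #T = ∑ x ∈ T, c := by rw [sum_const, nsmul_eq_mul, mul_comm]
      _ ≤ ∑ x ∈ T, e x ^ 2 := sum_le_sum hc
      _ ≤ ∑ x ∈ univ.filter (fun x => x ∉ Z), e x ^ 2 :=
          sum_le_sum_of_subset_of_nonneg (fun x hx => mem_filter.2 ⟨mem_univ _, hT x hx⟩) fun x _ _ => sq_nonneg _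
      _ ≤ 56 := hoff_le
  have hdiv4 : ∀ y, y ∉ Z → (4 : ℤ) ∣ e y := by
    by_contra hcon
    push Not at hcon
    obtain ⟨p, hp, hp4⟩ := hcon
    have hp2 : ∀ y, y ∉ Z → e y = 2 * (e y / 2) := fun y hy =>
      (Int.mul_ediv_cancel' (even_iff_two_dvd.1 (heeven y hy))).symm
    rcases ws_erm_round V₀ h0 hadd hcardV9 p (fun y => e y / 2) 5 (fun b hb a ha => by
        have hpts : ∀ ε : Fin (5 + 1) → Bool, (fun j => b j ^^ decide (Odd #(univ.filter fun i => ε i && a i j))) ∉ Z :=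
          fun ε => ws_flatPt_mem V₀ h0 (· ∉ Z) hPV' (5 + 1) b (hcos_out p hp b hb) a ha ε
        have h4 := hflat6 b a
        rw [sum_congr rfl fun ε _ => hp2 _ (hpts ε), ← mul_sum] at h4
        obtain ⟨k, hk⟩ := h4
        exact ⟨k, by linarith⟩) with hev | hbig
    · have := hev p (mem_image.2 ⟨zeroVec, h0, bxor_zeroVec p⟩)
      apply hp4
      obtain ⟨k, hk⟩ := this
      exact ⟨k, by rw [hp2 p hp, hk]; ring⟩
    · have hT := hoff_count ((V₀.image (bxor p)).filter fun x => Odd (e x / 2)) 4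
        (fun x hx => hcos_out p hp x (mem_filter.1 hx).1) (fun x hx => by
          have hx' := (mem_filter.1 hx)
          have hxZ : x ∉ Z := hcos_out p hp x hx'.1
          have h0' := Int.odd_iff.1 hx'.2
          have h2 := hp2 x hxZ
          have : e x ≤ -2 ∨ 2 ≤ e x := by omega
          have := tp_sq_ge (k := 2) (by norm_num) this
          linarith)
      norm_num at hbig
      have : (16 : ℤ) ≤ #((V₀.image (bxor p)).filter fun x => Odd (e x / 2)) := by exact_mod_cast (by omega)
      linarith
  -- round 2: `8 ∣ e` off `Z`
  have hdiv8 : ∀ y, y ∉ Z → (8 : ℤ) ∣ e y := by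
    by_contra hcon
    push Not at hcon
    obtain ⟨p, hp, hp8⟩ := hcon
    have hp4 : ∀ y, y ∉ Z → e y = 4 * (e y / 4) := fun y hy => (Int.mul_ediv_cancel' (hdiv4 y hy)).symm
    rcases ws_erm_round V₀ h0 hadd hcardV9 p (fun y => e y / 4) 6 (fun b hb a ha => by
        have hpts : ∀ ε : Fin (6 + 1) → Bool, (fun j => b j ^^ decide (Odd #(univ.filter fun i => ε i && a i j))) ∉ Z :=
          fun ε => ws_flatPt_mem V₀ h0 (· ∉ Z) hPV' (6 + 1) b (hcos_out p hp b hb) a ha ε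
        have h8 := hflat7 b a
        rw [sum_congr rfl fun ε _ => hp4 _ (hpts ε), ← mul_sum] at h8
        obtain ⟨k, hk⟩ := h8
        exact ⟨k, by linarith⟩) with hev | hbig
    · have := hev p (mem_image.2 ⟨zeroVec, h0, bxor_zeroVec p⟩)
      apply hp8
      obtain ⟨k, hk⟩ := this
      exact ⟨k, by rw [hp4 p hp, hk]; ring⟩
    · have hT := hoff_count ((V₀.image (bxor p)).filter fun x => Odd (e x / 4)) 16
        (fun x hx => hcos_out p hp x (mem_filter.1 hx).1) (fun x hx => by
          have hx' := (mem_filter.1 hx)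
          have hxZ : x ∉ Z := hcos_out p hp x hx'.1
          have h0' := Int.odd_iff.1 hx'.2
          have h2 := hp4 x hxZ
          have : e x ≤ -4 ∨ 4 ≤ e x := by omega
          have := tp_sq_ge (k := 4) (by norm_num) this
          linarith)
      norm_num at hbig
      have : (8 : ℤ) ≤ #((V₀.image (bxor p)).filter fun x => Odd (e x / 4)) := by exact_mod_cast (by omega)
      linarith
  -- round 3: `e = 0` off `Z`
  have hoff0 : ∀ y, y ∉ Z → e y = 0 := by
    intro y hy
    by_contra hne0
    obtain ⟨k, hk⟩ := hdiv8 y hy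
    have : e y ≤ -8 ∨ 8 ≤ e y := by omega
    have h64 := tp_sq_ge (k := 8) (by norm_num) this
    have := hoff_count {y} 64 (fun x hx => by rw [mem_singleton.1 hx]; exact hy) (fun x hx => by rw [mem_singleton.1 hx]; linarith)
    norm_num at this
  exact hoff0


/-! ### Step 2: (H3) and (H4) on the flat -/

/-- **(H3) and (H4).**  In the situation of `tw6_off_flat`, once the residual `e = u'' − (−1)^f` vanishes off `Z`, three transversal
directions localise the 6- and 7-flat sums of `u − 4(−1)^f = 4e` (`u = 4u''`) to `Z`: every parametrised 3-flat sum of `e` inside `Z` is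
`≡ 0 (mod 4)` and every 4-flat sum is `≡ 0 (mod 8)`. [this work] -/
theorem tw6_H34 (f g : (Fin (6 + 6) → Bool) → Bool) (hf : IsDegLeFun 3 f) (hg : IsDegLeFun 3 g)
    (u'' : (Fin (6 + 6) → Bool) → ℤ) (hu'' : ∀ x, W (fun y => signOf (g y)) x = (2 : ℝ) ^ 6 * (u'' x : ℝ))
    (V₀ : Finset (Fin (6 + 6) → Bool)) (xZ : Fin (6 + 6) → Bool) (h0 : zeroVec ∈ V₀)
    (hadd : ∀ a ∈ V₀, ∀ b ∈ V₀, bxor a b ∈ V₀) (hcardV : #V₀ = 512)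
    (hS : (univ.filter fun x : Fin (6 + 6) → Bool => ¬ Odd (u'' x)) = V₀.image (bxor xZ))
    (hoff0 : ∀ y, y ∉ (univ.filter fun x : Fin (6 + 6) → Bool => ¬ Odd (u'' x)) → u'' y - sZ (f y) = 0) :
    (∀ x ∈ (univ.filter fun x : Fin (6 + 6) → Bool => ¬ Odd (u'' x)), ∀ a b c : Fin (6 + 6) → Bool,
      a ∈ V₀ → b ∈ V₀ → c ∈ V₀ →
      (4 : ℤ) ∣ ∑ ε : Fin 3 → Bool, (u'' (fun j => x j ^^ decide (Odd #(univ.filter fun i =>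
        ε i && (![a, b, c] : Fin 3 → Fin (6 + 6) → Bool) i j))) - sZ (f (fun j => x j ^^ decide (Odd #(univ.filter fun i =>
        ε i && (![a, b, c] : Fin 3 → Fin (6 + 6) → Bool) i j)))))) ∧
    (∀ x ∈ (univ.filter fun x : Fin (6 + 6) → Bool => ¬ Odd (u'' x)), ∀ a₀ a₁ a₂ a₃ : Fin (6 + 6) → Bool,
      a₀ ∈ V₀ → a₁ ∈ V₀ → a₂ ∈ V₀ → a₃ ∈ V₀ →
      (8 : ℤ) ∣ ∑ ε : Fin 4 → Bool, (u'' (fun j => x j ^^ decide (Odd #(univ.filter fun i =>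
        ε i && (![a₀, a₁, a₂, a₃] : Fin 4 → Fin (6 + 6) → Bool) i j))) - sZ (f (fun j => x j ^^ decide (Odd #(univ.filter fun i =>
        ε i && (![a₀, a₁, a₂, a₃] : Fin 4 → Fin (6 + 6) → Bool) i j)))))) := by
  classical
  set Z := univ.filter (fun x : Fin (6 + 6) → Bool => ¬ Odd (u'' x)) with hZdef
  set u : (Fin (6 + 6) → Bool) → ℤ := fun x => 4 * u'' x with hudef
  have hu : ∀ x, W (fun y => signOf (g y)) x = (2 : ℝ) ^ 4 * (u x : ℝ) := by
    intro x; rw [hu'' x]; simp only [u]; push_cast; ring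
  set e : (Fin (6 + 6) → Bool) → ℤ := fun x => u'' x - sZ (f x) with hedef
  show (∀ x ∈ Z, ∀ a b c : Fin (6 + 6) → Bool, a ∈ V₀ → b ∈ V₀ → c ∈ V₀ →
      (4 : ℤ) ∣ ∑ ε : Fin 3 → Bool, e (fun j => x j ^^ decide (Odd #(univ.filter fun i =>
        ε i && (![a, b, c] : Fin 3 → Fin (6 + 6) → Bool) i j)))) ∧
    (∀ x ∈ Z, ∀ a₀ a₁ a₂ a₃ : Fin (6 + 6) → Bool, a₀ ∈ V₀ → a₁ ∈ V₀ → a₂ ∈ V₀ → a₃ ∈ V₀ →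
      (8 : ℤ) ∣ ∑ ε : Fin 4 → Bool, e (fun j => x j ^^ decide (Odd #(univ.filter fun i =>
        ε i && (![a₀, a₁, a₂, a₃] : Fin 4 → Fin (6 + 6) → Bool) i j))))
  have hFe : ∀ y, u y - 4 * sZ (f y) = 4 * e y := fun y => by simp only [u, e]; ring
  have hPV : ∀ x, x ∈ Z → ∀ a ∈ V₀, bxor x a ∈ Z := fun x hx a ha => fl1_coset_vadd hadd hS hx ha

  -- ON Z: three transversal directions localise the 6-/7-flat sums: (H3) `4 ∣ Σ_{3-flat} e`, (H4) `8 ∣ Σ_{4-flat} e`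
  have hF0 : ∀ y, y ∉ Z → u y - 4 * sZ (f y) = 0 := fun y hy => by
    have h := hoff0 y hy
    simp only [u]
    linarith
  obtain ⟨t₁, -, t₂, -, t₃, -, n1, n2, n21, n3, n31, n32, n321⟩ := ep_dirs3 univ V₀ (by
    rw [hcardV, card_univ, Fintype.card_fun, Fintype.card_bool, Fintype.card_fin]; norm_num)
  have hz : ∀ p ∈ Z, ∀ w, w ∉ V₀ → u (bxor p w) - 4 * sZ (f (bxor p w)) = 0 :=
    fun p hp w hw => hF0 _ (fl1_coset_out h0 hadd hS hp hw)
  have hloc : ∀ {k : ℕ} (x : Fin (6 + 6) → Bool) (a : Fin k → Fin (6 + 6) → Bool),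
      (∀ ε : Fin k → Bool, (fun j => x j ^^ decide (Odd #(univ.filter fun i => ε i && a i j))) ∈ Z) →
      ∑ ε : Fin (k + 3) → Bool, (u (fun j => x j ^^ decide (Odd #(univ.filter fun i =>
          ε i && (Matrix.vecCons t₁ (Matrix.vecCons t₂ (Matrix.vecCons t₃ a)) : Fin (k + 3) → Fin (6 + 6) → Bool) i j))) -
        4 * sZ (f (fun j => x j ^^ decide (Odd #(univ.filter fun i =>
          ε i && (Matrix.vecCons t₁ (Matrix.vecCons t₂ (Matrix.vecCons t₃ a)) : Fin (k + 3) → Fin (6 + 6) → Bool) i j))))) =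
      ∑ ε : Fin k → Bool, 4 * e (fun j => x j ^^ decide (Odd #(univ.filter fun i => ε i && a i j))) := by
    intro k x a hin
    have key := ep_loc3 (fun y => u y - 4 * sZ (f y)) x t₁ t₂ t₃ a
      (fun ε => hz _ (hin ε) t₁ n1) (fun ε => hz _ (hin ε) t₂ n2)
      (fun ε => by rw [iw_bxor_assoc]; exact hz _ (hin ε) _ n21)
      (fun ε => hz _ (hin ε) t₃ n3)
      (fun ε => by rw [iw_bxor_assoc]; exact hz _ (hin ε) _ n31)
      (fun ε => by rw [iw_bxor_assoc]; exact hz _ (hin ε) _ n32)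
      (fun ε => by rw [iw_bxor_assoc, iw_bxor_assoc]; exact hz _ (hin ε) _ n321)
    beta_reduce at key
    rw [key]
    exact sum_congr rfl fun ε _ => hFe _
  have H3 : ∀ x ∈ Z, ∀ a b c : Fin (6 + 6) → Bool, a ∈ V₀ → b ∈ V₀ → c ∈ V₀ →
      (4 : ℤ) ∣ ∑ ε : Fin 3 → Bool, e (fun j => x j ^^ decide (Odd #(univ.filter fun i =>
        ε i && (![a, b, c] : Fin 3 → Fin (6 + 6) → Bool) i j))) := by
    intro x hx a b c ha hb hc
    have hin : ∀ ε : Fin 3 → Bool, (fun j => x j ^^ decide (Odd #(univ.filter fun i =>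
        ε i && (![a, b, c] : Fin 3 → Fin (6 + 6) → Bool) i j))) ∈ Z :=
      fun ε => fr_mem_flatPt3 V₀ h0 (· ∈ Z) hPV hx ![a, b, c] (fun i => by fin_cases i <;> assumption) ε
    have h16 := fs_flat_sum_dvd (e := 4) g u hg hu x ![t₁, t₂, t₃, a, b, c] (by norm_num)
    obtain ⟨zf, hzf⟩ := sl_sum_sZ_flat f hf x ![t₁, t₂, t₃, a, b, c]
    have hzf' : ∑ ε : Fin 6 → Bool, 4 * sZ (f (fun j => x j ^^ decide (Odd #(univ.filter fun i =>
          ε i && (![t₁, t₂, t₃, a, b, c] : Fin 6 → Fin (6 + 6) → Bool) i j)))) = 16 * zf := by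
      rw [← mul_sum, hzf]; norm_num; ring
    have h16n : (16 : ℤ) ∣ ∑ ε : Fin 6 → Bool, u (fun j => x j ^^ decide (Odd #(univ.filter fun i =>
          ε i && (![t₁, t₂, t₃, a, b, c] : Fin 6 → Fin (6 + 6) → Bool) i j))) := by
      have e16 : (2 : ℤ) ^ 4 = 16 := by norm_num
      rw [e16] at h16; exact h16
    have h16' : (16 : ℤ) ∣ ∑ ε : Fin 6 → Bool, (u (fun j => x j ^^ decide (Odd #(univ.filter fun i =>
          ε i && (![t₁, t₂, t₃, a, b, c] : Fin 6 → Fin (6 + 6) → Bool) i j))) -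
        4 * sZ (f (fun j => x j ^^ decide (Odd #(univ.filter fun i =>
          ε i && (![t₁, t₂, t₃, a, b, c] : Fin 6 → Fin (6 + 6) → Bool) i j))))) := by
      rw [sum_sub_distrib, hzf']
      exact dvd_sub h16n (Dvd.intro _ rfl)
    rw [hloc x ![a, b, c] hin, ← mul_sum] at h16'
    obtain ⟨k16, hk16⟩ := h16'
    exact ⟨k16, by linarith⟩
  have H4 : ∀ x ∈ Z, ∀ a₀ a₁ a₂ a₃ : Fin (6 + 6) → Bool, a₀ ∈ V₀ → a₁ ∈ V₀ → a₂ ∈ V₀ → a₃ ∈ V₀ →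
      (8 : ℤ) ∣ ∑ ε : Fin 4 → Bool, e (fun j => x j ^^ decide (Odd #(univ.filter fun i =>
        ε i && (![a₀, a₁, a₂, a₃] : Fin 4 → Fin (6 + 6) → Bool) i j))) := by
    intro x hx a₀ a₁ a₂ a₃ ha₀ ha₁ ha₂ ha₃
    have hin : ∀ ε : Fin 4 → Bool, (fun j => x j ^^ decide (Odd #(univ.filter fun i =>
        ε i && (![a₀, a₁, a₂, a₃] : Fin 4 → Fin (6 + 6) → Bool) i j))) ∈ Z :=
      fun ε => fr_mem_flatPt4 V₀ h0 (· ∈ Z) hPV hx ![a₀, a₁, a₂, a₃] (fun i => by fin_cases i <;> assumption) ε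
    have h32 := fs_flat_sum_dvd (e := 5) g u hg hu x ![t₁, t₂, t₃, a₀, a₁, a₂, a₃] (by norm_num)
    obtain ⟨zf, hzf⟩ := sl_sum_sZ_flat f hf x ![t₁, t₂, t₃, a₀, a₁, a₂, a₃]
    have hzf' : ∑ ε : Fin 7 → Bool, 4 * sZ (f (fun j => x j ^^ decide (Odd #(univ.filter fun i =>
          ε i && (![t₁, t₂, t₃, a₀, a₁, a₂, a₃] : Fin 7 → Fin (6 + 6) → Bool) i j)))) = 32 * zf := by
      rw [← mul_sum, hzf]; norm_num; ring
    have h32n : (32 : ℤ) ∣ ∑ ε : Fin 7 → Bool, u (fun j => x j ^^ decide (Odd #(univ.filter fun i =>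
          ε i && (![t₁, t₂, t₃, a₀, a₁, a₂, a₃] : Fin 7 → Fin (6 + 6) → Bool) i j))) := by
      have e32 : (2 : ℤ) ^ 5 = 32 := by norm_num
      rw [e32] at h32; exact h32
    have h32' : (32 : ℤ) ∣ ∑ ε : Fin 7 → Bool, (u (fun j => x j ^^ decide (Odd #(univ.filter fun i =>
          ε i && (![t₁, t₂, t₃, a₀, a₁, a₂, a₃] : Fin 7 → Fin (6 + 6) → Bool) i j))) -
        4 * sZ (f (fun j => x j ^^ decide (Odd #(univ.filter fun i =>
          ε i && (![t₁, t₂, t₃, a₀, a₁, a₂, a₃] : Fin 7 → Fin (6 + 6) → Bool) i j))))) := by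
      rw [sum_sub_distrib, hzf']
      exact dvd_sub h32n (Dvd.intro _ rfl)
    rw [hloc x ![a₀, a₁, a₂, a₃] hin, ← mul_sum] at h32'
    obtain ⟨k32, hk32⟩ := h32'
    exact ⟨k32, by linarith⟩
  exact ⟨H3, H4⟩

end Summit.QuantumAdvantage.QuantumAdvantage.Theorems.CubicForrelation.NearExactIsExact

end
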